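import Summits.FinalStateConjecture.FinalStateConjecture.Theses.TangentConeAtIPlus

/-!
# The weighted interior clause of `Cone` reads zero off the closure of the flat-chart domain
# (negative-side support for crux `DecoratedConeExhausts`, item stmt-FinalStateConjecture-17671)

In the shared predicate `Cone` of route TangentConeAtIPlus the scale-invariant interior flatness is
measured by `weightedCkSeminorm S_{τ,δ} 2 0 (𝓢.deviationExtend (Minkowski.backgroundOn U) Φ)` over
the sets `S_{τ,δ} = {x | x 0 = τ ∧ |x̲| ≤ (1 - δ) τ ∧ ∀ i, δ τ ≤ dᵢ x}`, which are NOT intersected with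
the flat-chart domain `U`; instead the integrand `deviationExtend` is the extension BY ZERO off `U`
(`Spacetime.deviationExtend_of_not_mem`). We record the consequence: the seminorm over any set
disjoint from `closure U` vanishes (`weightedCkSeminorm_deviationExtend_eq_zero`), so the whole
clause holds trivially as soon as the sets `S_{τ,δ}` eventually avoid `closure U`
(`weighted_interior_clause_of_eventually_disjoint`). Together with
`Negative/ConeTubeSwallowsLateHalfSpace.lean` (the covering clause never forces `U` to meet
`S_{τ,δ}`) this is why `Cone ∧ Holes` carry only local information around the declared holes
(vetting note of stmt-FinalStateConjecture-17671). Everything is proved; no definitions.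

## References

* R. Bartnik, CPAM 39 (1986), (1.2)–(1.3) (weighted `Cᵏ` norms). [folklore]
-/

noncomputable section

set_option linter.dupNamespace false

open Set Filter Topology
open scoped ENNReal

namespace Summit.FinalStateConjecture.FinalStateConjecture.Theorems.DecoratedConeExhausts.Negative

open Literature.Geometry.Lorentzian

section Seminorm

variable {F G : Type*} [NormedAddCommGroup F] [NormedSpace ℝ F] [NormedAddCommGroup G]
  [NormedSpace ℝ G]

/-- A weighted `Cᵏ` seminorm over `S` of a function vanishing near every point of `S` is zero
(all classical iterated derivatives vanish there). Bartnik 1986, (1.3). [folklore] -/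
theorem weightedCkSeminorm_eq_zero_of_eventuallyEq_zero {S : Set F} {f : F → G}
    (h : ∀ x ∈ S, f =ᶠ[𝓝 x] 0) (k : ℕ) (δ : ℝ) : weightedCkSeminorm S k δ f = 0 := by
  refine le_antisymm (iSup₂_le fun m _ ↦ iSup₂_le fun x hx ↦ ?_) bot_le
  have hm : iteratedFDeriv ℝ m f x = 0 := by
    rw [((h x hx).iteratedFDeriv ℝ m).eq_of_nhds]
    simp
  simp [hm]

end Seminorm

/-- **The weighted clause reads zero off `closure U`.** For a flat chart `Φ` on `U : Opens E4` and
any set `S` disjoint from `closure U`, the weighted `Cᵏ` seminorm over `S` of the zero-extended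
deviation `deviationExtend (Minkowski.backgroundOn U) Φ` vanishes, whatever `Φ` and the spacetime
are. [folklore] -/
theorem weightedCkSeminorm_deviationExtend_eq_zero (𝓢 : Spacetime.{0} 4) (U : TopologicalSpace.Opens E4)
    (Φ : U → 𝓢.carrier) {S : Set E4} (hS : Disjoint S (closure (U : Set E4))) (k : ℕ) (δ : ℝ) :
    weightedCkSeminorm S k δ (𝓢.deviationExtend (Minkowski.backgroundOn U) Φ) = 0 := by
  refine weightedCkSeminorm_eq_zero_of_eventuallyEq_zero (fun x hx ↦ ?_) k δ
  have hx : x ∈ (closure (U : Set E4))ᶜ := fun h ↦ hS.le_bot ⟨hx, h⟩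
  filter_upwards [isClosed_closure.isOpen_compl.mem_nhds hx] with y hy
  exact 𝓢.deviationExtend_of_not_mem (Minkowski.backgroundOn U) Φ
    (fun h ↦ hy (subset_closure h))

/-- **The weighted interior clause of `Cone` is void off the chart.** In the route's exact shape:
if the sup sets `{x | x 0 = τ ∧ |x̲| ≤ (1 - δ) τ ∧ ∀ i, δ τ ≤ dᵢ x}` eventually avoid `closure U`
(e.g. `U` a sublinear neighbourhood of the agreement annuli of the declared holes), the clause
`Tendsto (fun τ ↦ weightedCkSeminorm {…} 2 0 (deviationExtend (backgroundOn U) Φ)) atTop (𝓝 0)`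
holds for EVERY chart `Φ` into EVERY spacetime. [folklore] -/
theorem weighted_interior_clause_of_eventually_disjoint (𝓢 : Spacetime.{0} 4)
    (U : TopologicalSpace.Opens E4) (Φ : U → 𝓢.carrier) {N : ℕ} (d : Fin N → E4 → ℝ) (δ : ℝ)
    (h : ∀ᶠ τ : ℝ in atTop, Disjoint
      {x : E4 | x 0 = τ ∧ E4.spatialNorm x ≤ (1 - δ) * τ ∧ ∀ i, δ * τ ≤ d i x} (closure (U : Set E4))) :
    Tendsto (fun τ : ℝ ↦ weightedCkSeminorm
      {x : E4 | x 0 = τ ∧ E4.spatialNorm x ≤ (1 - δ) * τ ∧ ∀ i, δ * τ ≤ d i x} 2 0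
        (𝓢.deviationExtend (Minkowski.backgroundOn U) Φ)) atTop (𝓝 0) :=
  tendsto_const_nhds.congr' (h.mono fun _ hτ ↦
    (weightedCkSeminorm_deviationExtend_eq_zero 𝓢 U Φ hτ 2 0).symm)

end Summit.FinalStateConjecture.FinalStateConjecture.Theorems.DecoratedConeExhausts.Negative

end
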